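import Mathlib
import HarnessLib

/-!
# Format C: the path-graph bound (Schur test with the Perron weight `sin(kθ)`)

Route context: Fourier–Galerkin / Schur-complement certificates of Weil positivity on a window ("format C";
cell memo `run/shared/lean/pub/rh-explicit/rh-explicit-weil-10/FORMATC-DESIGN.md` §4.3, PRIME part; supporting
stmt-RiemannHypothesis-0098).  The far-coercivity lemma (L-C3a) bounds the prime part of the sector Gram, i.e. the
compression to `L²[−a,a]` of `Σ_ℓ Λ_ℓ (S_ℓ + S_ℓ*)` (`S_ℓ` = translation by `ℓ = e·log p < 2a`), from below by
`−A_op⁺`, `A_op⁺ = Σ_ℓ Λ_ℓ · 2cos(π/(V_ℓ + 1))`, `V_ℓ = ⌊2a/ℓ⌋ + 1`: fibrewise over `x₀ ∈ [−a, −a+ℓ)` the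
compressed `S_ℓ + S_ℓ*` is the adjacency matrix of a PATH with at most `V_ℓ` vertices, whose quadratic form is
bounded by its Perron eigenvalue `2cos(π/(V+1))` — versus the pointwise constant `2` that gives Yoshida's
`A(μ) = 2Σ_ℓ Λ_ℓ`.  At `a = 1` this is `3.13` against `5.85` and moves the far cut from `m ≈ 770` to `m ≈ 55`.

THIS FILE is the finite-dimensional core of that bound, with no function spaces:

* `WeilFormatC.two_mul_abs_mul_le_weighted` — `2|p q| ≤ r p² + r⁻¹ q²` (`r > 0`);
* `WeilFormatC.sin_succ_add_sin_pred` — `sin((k+2)θ) + sin(kθ) = 2 cos θ · sin((k+1)θ)`;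
* `WeilFormatC.pathGraph_two_mul_abs_sum_le` — **for every `n` and every real sequence `x`,
  `2 |Σ_{i<n} x_{i+1} x_{i+2}| ≤ 2cos(π/(n+2)) · Σ_{i<n+1} x_{i+1}²`** (the path with `n+1` vertices
  `x₁,…,x_{n+1}` and `n` edges; Schur test with weights `w_k = sin(kπ/(n+2)) > 0`, `w₀ = w_{n+2} = 0`).

The constant is sharp (equality at `x_k = sin(kπ/(n+2))`), but sharpness is not proved here.  Elementary real
algebra and trigonometry; standard axioms only.  The function-space step (fibre decomposition of
`⟨f(· − ℓ), f⟩_{L²[−a,a]}`) is NOT in this file.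
-/

-- `Summit.RiemannHypothesis.RiemannHypothesis.…` is the layout-mandated namespace (summit = problem name).
set_option linter.dupNamespace false

namespace Summit.RiemannHypothesis.RiemannHypothesis.Theorems.WeilFormatC

open Finset Real

/-- Weighted AM–GM with absolute values: `2|p·q| ≤ r·p² + r⁻¹·q²` for `r > 0`
(`(r|p| − |q|)² ≥ 0` divided by `r`). -/
theorem two_mul_abs_mul_le_weighted (p q : ℝ) {r : ℝ} (hr : 0 < r) :
    2 * |p * q| ≤ r * p ^ 2 + r⁻¹ * q ^ 2 := by
  rw [abs_mul]
  have h0 : 0 ≤ (r * |p| - |q|) ^ 2 := sq_nonneg _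
  have h1 : r⁻¹ * (r * |p| - |q|) ^ 2 = r * |p| ^ 2 - 2 * (|p| * |q|) + r⁻¹ * |q| ^ 2 := by
    field_simp
    ring
  have h2 : 0 ≤ r⁻¹ * (r * |p| - |q|) ^ 2 := mul_nonneg (inv_pos.mpr hr).le h0
  rw [h1, sq_abs, sq_abs] at h2
  linarith

/-- The three-term recurrence of the Perron weights: `sin((k+2)θ) + sin(kθ) = 2 cos θ · sin((k+1)θ)`. -/
theorem sin_succ_add_sin_pred (k : ℕ) (θ : ℝ) :
    Real.sin ((k + 2 : ℝ) * θ) + Real.sin ((k : ℝ) * θ)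
      = 2 * Real.cos θ * Real.sin ((k + 1 : ℝ) * θ) := by
  have h1 : ((k : ℝ) + 2) * θ = ((k : ℝ) + 1) * θ + θ := by ring
  have h2 : (k : ℝ) * θ = ((k : ℝ) + 1) * θ - θ := by ring
  rw [h1, h2, Real.sin_add, Real.sin_sub]
  ring

/-- Positivity of the Perron weights: for `1 ≤ k ≤ n+1`, `0 < sin(kπ/(n+2))`. -/
theorem sin_mul_pi_div_pos {n k : ℕ} (hk1 : 1 ≤ k) (hk2 : k ≤ n + 1) :
    0 < Real.sin ((k : ℝ) * (π / (n + 2))) := by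
  have hn : (0 : ℝ) < n + 2 := by positivity
  apply Real.sin_pos_of_pos_of_lt_pi
  · have : (0 : ℝ) < k := by exact_mod_cast hk1
    positivity
  · have hk : (k : ℝ) ≤ n + 1 := by exact_mod_cast hk2
    rw [mul_div_assoc']
    rw [div_lt_iff₀ hn]
    nlinarith [Real.pi_pos]

/-- **The path-graph bound.**  For every `n : ℕ` and every real sequence `x`,
`2 |Σ_{i<n} x(i+1)·x(i+2)| ≤ 2 cos(π/(n+2)) · Σ_{i<n+1} x(i+1)²`: the symmetric bilinear form of the path on the
`n+1` vertices `1, …, n+1` is bounded by `2cos(π/(n+2))` times the identity (Schur test with the weights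
`w_k = sin(kπ/(n+2))`, which satisfy `w_{k−1} + w_{k+1} = 2cos(π/(n+2))·w_k`, `w₀ = w_{n+2} = 0`). -/
theorem pathGraph_two_mul_abs_sum_le (n : ℕ) (x : ℕ → ℝ) :
    2 * |∑ i ∈ range n, x (i + 1) * x (i + 2)|
      ≤ 2 * Real.cos (π / (n + 2)) * ∑ i ∈ range (n + 1), x (i + 1) ^ 2 := by
  set θ : ℝ := π / (n + 2) with hθ
  set w : ℕ → ℝ := fun k ↦ Real.sin ((k : ℝ) * θ) with hw
  -- positivity of the weights on `1 ≤ k ≤ n+1`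
  have hwpos : ∀ k, 1 ≤ k → k ≤ n + 1 → 0 < w k := fun k h1 h2 ↦ by
    simp only [hw, hθ]; exact sin_mul_pi_div_pos h1 h2
  -- boundary values
  have hw0 : w 0 = 0 := by simp [hw]
  have hwtop : w (n + 2) = 0 := by
    simp only [hw, hθ]
    have : ((n + 2 : ℕ) : ℝ) * (π / (n + 2)) = π := by
      push_cast
      field_simp
    rw [this, Real.sin_pi]
  -- recurrence `w k + w (k+2) = 2 cos θ · w (k+1)`
  have hrec : ∀ k : ℕ, w (k + 2) + w k = 2 * Real.cos θ * w (k + 1) := by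
    intro k
    simp only [hw]
    push_cast
    exact sin_succ_add_sin_pred k θ
  -- termwise weighted AM–GM on the edges `(i+1, i+2)`, `i < n`
  have hterm : ∀ i ∈ range n, 2 * |x (i + 1) * x (i + 2)|
      ≤ (w (i + 2) / w (i + 1)) * x (i + 1) ^ 2 + (w (i + 1) / w (i + 2)) * x (i + 2) ^ 2 := by
    intro i hi
    rw [Finset.mem_range] at hi
    have h1 : 0 < w (i + 1) := hwpos (i + 1) (by omega) (by omega)
    have h2 : 0 < w (i + 2) := hwpos (i + 2) (by omega) (by omega)
    have h := two_mul_abs_mul_le_weighted (x (i + 1)) (x (i + 2)) (div_pos h2 h1)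
    rwa [inv_div] at h
  -- sum of the termwise bounds
  have hsum : 2 * |∑ i ∈ range n, x (i + 1) * x (i + 2)|
      ≤ ∑ i ∈ range n, ((w (i + 2) / w (i + 1)) * x (i + 1) ^ 2
          + (w (i + 1) / w (i + 2)) * x (i + 2) ^ 2) := by
    calc 2 * |∑ i ∈ range n, x (i + 1) * x (i + 2)|
        ≤ 2 * ∑ i ∈ range n, |x (i + 1) * x (i + 2)| := by
          gcongr; exact Finset.abs_sum_le_sum_abs _ _
      _ = ∑ i ∈ range n, 2 * |x (i + 1) * x (i + 2)| := by rw [Finset.mul_sum]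
      _ ≤ _ := Finset.sum_le_sum hterm
  refine hsum.trans (le_of_eq ?_)
  -- reassemble: first part extended to `range (n+1)` using `w (n+2) = 0`
  have hA : ∑ i ∈ range n, (w (i + 2) / w (i + 1)) * x (i + 1) ^ 2
      = ∑ i ∈ range (n + 1), (w (i + 2) / w (i + 1)) * x (i + 1) ^ 2 := by
    rw [Finset.sum_range_succ, hwtop, zero_div, zero_mul, add_zero]
  -- second part shifted to `range (n+1)` using `w 0 = 0`
  have hB : ∑ i ∈ range n, (w (i + 1) / w (i + 2)) * x (i + 2) ^ 2
      = ∑ i ∈ range (n + 1), (w i / w (i + 1)) * x (i + 1) ^ 2 := by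
    rw [Finset.sum_range_succ' (fun i ↦ (w i / w (i + 1)) * x (i + 1) ^ 2), hw0, zero_div, zero_mul,
      add_zero]
  rw [Finset.sum_add_distrib, hA, hB, ← Finset.sum_add_distrib, Finset.mul_sum]
  refine Finset.sum_congr rfl fun i hi ↦ ?_
  rw [Finset.mem_range] at hi
  have h1 : 0 < w (i + 1) := hwpos (i + 1) (by omega) (by omega)
  have hr := hrec i
  have : w (i + 2) / w (i + 1) + w i / w (i + 1) = 2 * Real.cos θ := by
    rw [← add_div, div_eq_iff h1.ne', hr]
  calc (w (i + 2) / w (i + 1)) * x (i + 1) ^ 2 + (w i / w (i + 1)) * x (i + 1) ^ 2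
      = (w (i + 2) / w (i + 1) + w i / w (i + 1)) * x (i + 1) ^ 2 := by ring
    _ = 2 * Real.cos θ * x (i + 1) ^ 2 := by rw [this]

/-- The same bound without the absolute value, as a two-sided estimate of the path's quadratic form
`2 Σ_{i<n} x(i+1) x(i+2)` (lower side), the form in which the prime part of the far Gram is bounded below. -/
theorem pathGraph_neg_le_two_mul_sum (n : ℕ) (x : ℕ → ℝ) :
    -(2 * Real.cos (π / (n + 2)) * ∑ i ∈ range (n + 1), x (i + 1) ^ 2)
      ≤ 2 * ∑ i ∈ range n, x (i + 1) * x (i + 2) := by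
  have h := pathGraph_two_mul_abs_sum_le n x
  have := neg_abs_le (∑ i ∈ range n, x (i + 1) * x (i + 2))
  linarith

end Summit.RiemannHypothesis.RiemannHypothesis.Theorems.WeilFormatC
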